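/-
Origin: expansion seat `planner-pub-hodgecm-pv09-g7-0`, handover #4 13:58:21Z (md5 9c9e9bc52c0ddb8309a5906c9953cecf; NEW additive leaf, kind L5 consistency; TWO import rewrites by the generic ^import Pv[0-9]+g[0-9]+\. -> import HodgeCM.PerL34. rule: Pv09g7.GenuineCoeffMatch -> HodgeCM.PerL34.GenuineCoeffMatch (this seat #3, r30) and Pv09g6.GenuineTensorEnd -> HodgeCM.PerL34.GenuineTensorEnd (r29 landed); land AFTER #3; HOLD iff #3 held; audit name HodgeCM.PerL3 (`HOME/pub-hodgecm-pv09-g7/lean/Pv09g7/GenuineCoeffMatchSmoke.lean`, md5 9c9e9bc5, 105 lines);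
landed by the gen-8 packager in gate run 30 as `HodgeCM/PerL34/GenuineCoeffMatchSmoke.lean` (import ^import Pv09g7\.GenuineCoeffMatch[ \t]*$→import HodgeCM.PerL34.GenuineCoeffMatch ×1; import ^import Pv09g6\.GenuineTensorEnd[ \t]*$→import HodgeCM.PerL34.GenuineTensorEnd ×1).
-/
/-
Copyright: HodgeCM publication cell (pub-hodgecm), seam S3 (𝓕-side / genuine idelic torus end; consistency
leaf: the coefficient-matching END specialises to the RUN-29 genuine tensor END).  Prover seat pub-hodgecm-pv09-g7
(DAG-node prover #09, generation 7), file #4; intended final place `HodgeCM/PerL34/GenuineCoeffMatchSmoke.lean`.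
WIP imports: `Pv09g7.GenuineCoeffMatch` ↦ `HodgeCM.PerL34.GenuineCoeffMatch` (this seat's #3, RUN 30, 59fddeeb),
`Pv09g6.GenuineTensorEnd` ↦ `HodgeCM.PerL34.GenuineTensorEnd` (pv09-g6 #4, LANDED RUN 29).  Complete proofs, no
new axioms, nothing cited.  Released under the package licence.
-/
import Summits.HodgeConjecture.HodgeCM.PerL34.GenuineCoeffMatch_2
import Summits.HodgeConjecture.HodgeCM.PerL34.GenuineTensorEnd

/-!
# Consistency: the coefficient-matching END ⇒ the RUN-29 genuine tensor END

Kind L5 (consistency / specialisation check; no new mathematics).  pv09-g6's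
`RestrictedTensor.Genuine.exists_compactDomain_thetaLift_ne_zero_genuine_tensor` (LANDED gate RUN 29) is the S3
END for a doubling datum `D` ON the restricted tensor product `⊗′H` with the model equality `hω : D.ω = ⊗′ρ`.
This seat's #3 `…_genuine_tensor_of_coeffMatch` asks instead for a datum on ANY inner-product space and the one
scalar identity `⟪φ, D.ω g φ⟫ = ⟪φ•, ⊗′ρ(g) φ•⟫`.  Here the former is RE-DERIVED from the latter
(`Smoke.end_r29_of_coeffMatch`: take `Sp := ⊗′H`, `φ := φ•`; both extra hypotheses `hloc`, `hcoeff` are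
discharged by `rw [hω]`), and an `example` records that the re-derived statement and the landed one are the same
proposition (`rfl`).  So the RUN-30 interface is a genuine weakening of the RUN-29 one and its hypotheses are jointly
satisfiable wherever RUN 29's are.  Nothing cited, nothing posited.
-/

set_option autoImplicit false

noncomputable section

open MeasureTheory NumberField IsDedekindDomain
open scoped RestrictedProduct InnerProductSpace

namespace HodgeCM.PerL34.RestrictedTensor.Genuine.Smoke

open HodgeCM.PerL34.SplitShells HodgeCM.PerL34.AdelicFactorisation HodgeCM.PerL34.RestrictedMeasure
open HodgeCM.PerL34.NoSmallSubgroups HodgeCM.PerL34.EulerFactorisation HodgeCM.PerL34.DiscreteFD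
open HodgeCM.PerL34.LocalFactors HodgeCM.PerL34.LocalFactors.DilationModel
open HodgeCM.PerL34.LocalModulus HodgeCM.PerL34.SplitPlaceDilation
open HodgeCM.PerL34.RallisIP HodgeCM.PerL34.Doubling HodgeCM.PerL34.N31d
open HodgeCM.PerL34.IdelePlaces HodgeCM.PerL34.RestrictedRegroup HodgeCM.PerL34.RestrictedCutout
open HodgeCM.PerL34.IdelicTorusModel HodgeCM.PerL34.IdelicTorusModel.Genuine HodgeCM.PerL34.PureTensor

variable (L : Type) [Field L] [NumberField L] [IsCMField L]

set_option synthInstance.maxHeartbeats 200000 in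
-- (as in the END theorems: the `SMul Γ (Model L)` instance behind `IsFundamentalDomain` is slow to find)
/-- **RUN 29's genuine tensor END, re-derived from the coefficient-matching END of #3.**  Same binders and same
conclusion as pv09-g6's `exists_compactDomain_thetaLift_ne_zero_genuine_tensor`; proof = #3's
`…_genuine_tensor_of_coeffMatch` at `φ := φ•`, with `hloc` from `continuous_rep_mulSingle_apply` and `hcoeff`
trivial after `rw [hω]`. -/
theorem end_r29_of_coeffMatch [DecidableEq (Place (maximalRealSubfield L))]
    [∀ v : HeightOneSpectrum (𝓞 (maximalRealSubfield L)), MeasurableSpace (v.adicCompletion (maximalRealSubfield L))]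
    [∀ v : HeightOneSpectrum (𝓞 (maximalRealSubfield L)), BorelSpace (v.adicCompletion (maximalRealSubfield L))]
    (S₀ : Finset (Place (maximalRealSubfield L)))
    {W : Type} [AddCommGroup W] [Module L W]
    {H Sbox : Type} [Group H] [AddCommGroup Sbox] [Module ℂ Sbox]
    {h : W →ₗ⋆[L] W →ₗ[L] L} (hW : IsLine L W) (hh : Anisotropic h)
    (D : DoublingDatum (Model L) H (Space (unitFam L)) Sbox) (GU : ThetaSide (Space (unitFam L)) Sbox)
    (j : isomBox h →* H) (hj : ∀ d : unitary L, j ⟨iotaSnd d, iotaSnd_mem h d⟩ = D.ι (1, unitaryToModel L d))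
    (χ : Model L →* Circle) (hχΓ : ∀ d : unitary L, χ (unitaryToModel L d) = 1)
    (hχVΓ : ∀ d : unitary L, D.χV (unitaryToModel L d) = 1)
    {hP : ∀ Ψ : Sbox, ∀ p ∈ (stabDelta L W).subgroupOf (isomBox h), ∀ x : H, D.fSW Ψ (j p * x) = D.fSW Ψ x}
    (P : GluePrintInputs D GU h j hP)
    {T' : Finset (Place (maximalRealSubfield L))}
    (hχT' : RestrictedProduct.boxSubgroup (genLevel L) T' ≤ χ.ker)
    (hlocχ : ∀ i ∈ T', Continuous fun g : locTorus (maximalRealSubfield L) L i =>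
      χ (RestrictedProduct.mulSingle (genLevel L) i g))
    {S : Finset (Place (maximalRealSubfield L))} (hT'S : T' ⊆ S)
    (hS : ∀ v : InfinitePlace (maximalRealSubfield L), Sum.inl v ∈ S)
    {ν : ∀ i : Place (maximalRealSubfield L),
      ((basePlaceOf L i).adicCompletion (maximalRealSubfield L))ˣ →* Circle}
    (hν : ∀ i, i ∉ S → IsSplitPlace L i →
      ∀ u : ((basePlaceOf L i).adicCompletion (maximalRealSubfield L))ˣ,
        ‖(u : (basePlaceOf L i).adicCompletion (maximalRealSubfield L))‖ = 1 → ν i u = 1)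
    (hνc : ∀ i, IsSplitPlace L i → Continuous (ν i))
    (x₀ : ∀ i : Place (maximalRealSubfield L), Fin 3 → (basePlaceOf L i).adicCompletion (maximalRealSubfield L))
    (hx₀ : ∀ i ∈ S, IsSplitPlace L i → x₀ i ≠ 0)
    (hω : D.ω = rep (admissible L hν hχT')) [IsFiniteMeasure GU.μ] :
    ∃ 𝓕 : Set (Model L), IsCompact 𝓕 ∧ (interior 𝓕).Nonempty ∧ MeasurableSet 𝓕 ∧
      IsFundamentalDomain (unitaryToModel L).range 𝓕
        (haarDatum (genLevel L) (isCompact_genLevel L) (isOpen_genLevel L) S₀).μ ∧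
      (haarDatum (genLevel L) (isCompact_genLevel L) (isOpen_genLevel L) S₀).μ 𝓕 ≠ 0 ∧
      (haarDatum (genLevel L) (isCompact_genLevel L) (isOpen_genLevel L) S₀).μ 𝓕 ≠ ⊤ ∧
      ∀ [IsFiniteMeasure (((haarDatum (genLevel L) (isCompact_genLevel L) (isOpen_genLevel L) S₀).μ).restrict 𝓕)]
        (hk : Measurable (Function.uncurry
          (thetaFn D GU (phi L S x₀ (radius L S hνc hχT' hlocχ x₀ hx₀))))) {Ck : ℝ} (hCk : 0 ≤ Ck)
        (hkC : ∀ q u, ‖thetaFn D GU (phi L S x₀ (radius L S hνc hχT' hlocχ x₀ hx₀)) q u‖ ≤ Ck),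
        PeterssonFubini.theta GU.μ
          (((haarDatum (genLevel L) (isCompact_genLevel L) (isOpen_genLevel L) S₀).μ).restrict 𝓕) hk
          (measurable_coe_char (genLevel L) (isOpen_genLevel L) χ hχT' hlocχ) hCk hkC (norm_coe_char_le χ) ≠ 0 :=
  exists_compactDomain_thetaLift_ne_zero_genuine_tensor_of_coeffMatch L S₀ hW hh D GU j hj χ hχΓ hχVΓ P
    (by rw [hω]; exact fun i v => continuous_rep_mulSingle_apply L S hν hχT' hνc hlocχ i v)
    hχT' hlocχ hT'S hS hν hνc x₀ hx₀ (phi L S x₀ (radius L S hνc hχT' hlocχ x₀ hx₀)) (fun g => by rw [hω])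

/-- the re-derived statement IS the landed RUN-29 statement (same proposition; `rfl` by proof irrelevance once
the two types agree). -/
example [DecidableEq (Place (maximalRealSubfield L))]
    [∀ v : HeightOneSpectrum (𝓞 (maximalRealSubfield L)), MeasurableSpace (v.adicCompletion (maximalRealSubfield L))]
    [∀ v : HeightOneSpectrum (𝓞 (maximalRealSubfield L)), BorelSpace (v.adicCompletion (maximalRealSubfield L))] :
    @end_r29_of_coeffMatch L _ _ _ _ _ _ =
      @exists_compactDomain_thetaLift_ne_zero_genuine_tensor L _ _ _ _ _ _ := rfl

end HodgeCM.PerL34.RestrictedTensor.Genuine.Smoke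

end
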